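/-
Copyright (c) 2026. All rights reserved.
Released under Apache 2.0 license as described in the file LICENSE.
Authors: abc-iut cell, prover seat abc-iut-w6-d028 (gen 4; RQ7 follow-up of p443182), over abc-iut-w4-d095's
`MLFLogFrobeniusNonarchArrows.lean` and abc-iut-L4-t9's `MLFLogFrobeniusFunctors.lean` (consumed by name).
-/
import Literature.AnabelianGeometry.AbsoluteAnabelian.AbsTopIII.MLFLogFrobeniusNonarchArrows
import HarnessLib

/-!
# [AbsTopIII] Definition 5.4 (iii): the diagram `Γ⃗^log_non` COMMUTES at the MLF model

S. Mochizuki, *Topics in absolute anabelian geometry III: global reconstruction algorithms*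
[MochizukiAbsTopIII2015]; locators = pages of the author's manuscript (`paper:url-5493eb38cbb7`):
Def 5.4 (iii) p. 126 l. 15–29: "Consider, in the notation of Definition 3.1, (iv), the *commutative diagram*
of natural maps `𝒪^×_k̄ ↪ k̄^× ↪ k̄` / `↓ shell`, `↓` / `k~ →(id) k~ ↪ (k̄^×)^pf` — where we recall that
`k~ := (𝒪^×_k̄)^pf`"; Def 3.1 (i) p. 66 l. 21–28 (`log_k̄ : k~ ⥲ k̄`), Def 3.1 (iv) p. 69 (`ι_×`, `ι_log`).

PROOF-ONLY companion (no `def` / `instance`).  abc-iut-w4-d095's `MLFLogFrobeniusNonarchArrows.lean` realises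
the six vertices and six arrows of `Γ⃗^log_non` over abc-iut-L4-t9's model `TFModel p` (log-coordinates
`k~ = k̄`); this file records the one word of print that file leaves implicit — **"commutative"**:
* `TFModel.iotaShell_iotaAddToPf_apply` — the left square on arithmetic data:
  `[log_k̄⁻¹(log_k̄ u)] = [u]` in `(k̄^×)^pf` for `u ∈ 𝒪^×_k̄`, i.e. shell-arrow then `k~ ↪ (k̄^×)^pf` equals
  `𝒪^× ↪ k̄^×` then `ι_×` (abc-iut-L6-d2's `logEquiv_mk`, abc-iut-L4-t9's `unitsPfIncl_mk`);
* `TFModel.iotaShell_iotaPostLogId_iotaAddToPf_apply` — print's cell through the post-log vertex (`k~ →(id) k~`);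
* `TFModel.iotaShell_comp_iotaAddToPf` — the same square as an equation of natural transformations
  `λ^{𝒪×} ⟶ λ^{×pf}` (the arrows are the identity on `Π`);
* `TFModel.iotaTimesToAdd_iotaAddToPf_app` — the second cell: `k̄^× ↪ k̄ = k~ ↪ (k̄^×)^pf` is abc-iut-L4-t9's
  `ι_log` componentwise (the author's `iotaLogMap_eq_addToPf`, restated through the arrows).

HONEST FRAMING: a statement about the kernel MODEL (abc-iut-L4-t9's conventions); refereed pre-IUT material;
nothing here bears on [IUTchIII] Cor. 3.12; no side taken; typed ≠ proved.
-/

set_option autoImplicit false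

noncomputable section

namespace Literature.AnabelianGeometry.AbsoluteAnabelian.AbsTopIII

open CategoryTheory

namespace TFModel

variable (p : ℕ) [hp : Fact p.Prime]

/-- **The left square of `Γ⃗^log_non` commutes on arithmetic data**: for `u ∈ 𝒪^×_k̄`, going down the
shell-arrow (`log_k̄`) and then along `k~ ↪ (k̄^×)^pf` (`y ↦ [log_k̄⁻¹(y)]`) gives the class `[u]`, i.e. the
same as `𝒪^×_k̄ ↪ k̄^×` followed by `ι_× : k̄^× → (k̄^×)^pf`.
[cite: MochizukiAbsTopIII2015, Definition 5.4 (iii) p.126] -/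
theorem iotaShell_iotaAddToPf_apply (A : TFModel p) (u : UnitsCarrier p) :
    ((iotaAddToPf p).app A).homM (((iotaShell p).app A).homM u) =
      ((iotaTimes p).app A).homM (((iotaUnitsToTimes p).app A).homM u) := by
  -- `u` as an element of abc-iut-L6-d2's `unitGroup ℚ_p ℚ̄_p`
  let w : unitGroup ℚ_[p] (PadicAlgCl p) :=
    ⟨Units.mk0 u.val (ne_zero_of_mem_unitSubmonoid u.val_mem), u.val_mem⟩
  have hw : (padicLog p).logEquiv (QuotientGroup.mk w) =
      Multiplicative.ofAdd ((padicLog p).log u.val) := by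
    rw [GaloisPadicLog.logEquiv_mk]; rfl
  have hsymm : (padicLog p).logEquiv.symm (Multiplicative.ofAdd ((padicLog p).log u.val)) =
      QuotientGroup.mk w := by
    rw [← hw, MulEquiv.symm_apply_apply]
  change unitsPfIncl ((padicLog p).logEquiv.symm (Multiplicative.ofAdd ((padicLog p).log u.val))) =
    timesToPf (UnitsCarrier.toTimes u)
  rw [hsymm, unitsPfIncl_mk]
  rfl

/-- **Print's cell verbatim (the pentagon through the post-log vertex)**: `𝒪^× →(shell) k~ →(id) k~ ↪ (k̄^×)^pf`
equals `𝒪^× ↪ k̄^× →(ι_×) (k̄^×)^pf` on arithmetic data (the post-log arrow is the identity in log-coordinates).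
[cite: MochizukiAbsTopIII2015, Definition 5.4 (iii) p.126] -/
theorem iotaShell_iotaPostLogId_iotaAddToPf_apply (A : TFModel p) (u : UnitsCarrier p) :
    ((iotaAddToPf p).app A).homM (((iotaPostLogId p).app A).homM (((iotaShell p).app A).homM u)) =
      ((iotaTimes p).app A).homM (((iotaUnitsToTimes p).app A).homM u) :=
  iotaShell_iotaAddToPf_apply p A u

/-- **The left square of `Γ⃗^log_non` commutes** as an equation of natural transformations
`(Π ↷ 𝒪^×_k̄) ⟶ (Π ↷ (k̄^×)^pf)`: `shell ≫ (k~ ↪ (k̄^×)^pf) = (𝒪^× ↪ k̄^×) ≫ ι_×` (both are the identity on `Π`).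
[cite: MochizukiAbsTopIII2015, Definition 5.4 (iii) p.126] -/
theorem iotaShell_comp_iotaAddToPf :
    iotaShell p ≫ iotaAddToPf p = iotaUnitsToTimes p ≫ iotaTimes p := by
  ext A
  exact TSObj.Hom.ext rfl (funext fun u => iotaShell_iotaAddToPf_apply p A u)

/-- **The second cell of `Γ⃗^log_non`**: `k̄^× ↪ k̄ = k~` (space-link inclusion, read in log-coordinates)
followed by `k~ ↪ (k̄^×)^pf` is abc-iut-L4-t9's `ι_log`, componentwise (the author's `iotaLogMap_eq_addToPf`).
[cite: MochizukiAbsTopIII2015, Definition 3.1 (iv) p.69] -/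
theorem iotaTimesToAdd_iotaAddToPf_app (A : TFModel p) :
    (iotaTimesToAdd p).app A ≫ (iotaAddToPf p).app A = (iotaLog p).app A :=
  TSObj.Hom.ext rfl (funext fun u => (iotaLogMap_eq_addToPf p u).symm)

/-- On arithmetic data, the composite `𝒪^×_k̄ → (k̄^×)^pf` along EITHER path of the square is the class map
`u ↦ [u]` (`timesToPf ∘ toTimes`). [cite: MochizukiAbsTopIII2015, Definition 5.4 (iii) p.126] -/
theorem iotaShell_iotaAddToPf_apply_eq_timesToPf (A : TFModel p) (u : UnitsCarrier p) :
    ((iotaAddToPf p).app A).homM (((iotaShell p).app A).homM u) = timesToPf (UnitsCarrier.toTimes u) :=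
  iotaShell_iotaAddToPf_apply p A u

end TFModel

end Literature.AnabelianGeometry.AbsoluteAnabelian.AbsTopIII

end
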